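import Mathlib.Topology.Algebra.InfiniteSum.Real
import Mathlib.NumberTheory.LSeries.RiemannZeta
import Mathlib.LinearAlgebra.Dimension.Finrank
import HarnessLib

-- provenance: harness21/H21/H21/Prelude/TranscendEllArithS/MultipleZeta.lean @ efa73f9 (interim HEAD d8f2665); M5 mechanical rewrite
/-!
# Multiple zeta values, weight spaces, Zagier dimensions, Hoffman indices

Trunk `TranscendEllArithS`, concept C3 (`multiple_zeta_values`), feeding the `Periods` family
(Kontsevich–Zagier periods, multiple zeta values).

For an index `s = (s₁, …, s_k)` of positive integers with `s₁ ≥ 2` (an *admissible* index) the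
multiple zeta value is
`ζ(s₁, …, s_k) = ∑_{n₁ > n₂ > ⋯ > n_k ≥ 1} n₁^{-s₁} ⋯ n_k^{-s_k}`
(Zagier's 1994 convention). Its *weight* is `s₁ + ⋯ + s_k` and its *depth* is `k`. We define

* `Literature.NumberTheory.Transcendental.MZV.IsAdmissible`, `Literature.NumberTheory.Transcendental.MZV.weight`, `Literature.NumberTheory.Transcendental.MZV.depth`, `Literature.NumberTheory.Transcendental.MZV.IsHoffman` (all entries in
  `{2, 3}`, Hoffman 1997);
* `Literature.multipleZeta s : ℝ` as a `tsum` over strictly decreasing positive tuples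
  `n : Fin s.length → ℕ` (junk value `0` by the `tsum` convention when the series diverges, e.g.
  for `s = [1]`);
* `Literature.mzvSpace w : Submodule ℚ ℝ`, the `ℚ`-span of admissible MZVs of weight `w`, and
  `Literature.hoffmanSpan w`, the span of the Hoffman elements of weight `w`;
* `Literature.zagierDim : ℕ → ℕ`, Zagier's conjectural dimensions `d₀ = 1, d₁ = 0, d₂ = 1,
  d_n = d_{n-2} + d_{n-3}`.

Mathlib has `riemannZeta` but no multiple zeta values (checked by grep). The Catalan constant is
*not* defined here: it is `Literature.NumberTheory.Transcendental.catalanConstant` in `H21/Statements/Periods/Wave0.lean`.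
Likewise the link `multipleZeta [k] = Literature.Periods.zetaValue k` is stated in the MZV statements
file, since a Prelude file does not import Statements.

## References

* D. Zagier, *Values of zeta functions and their applications*, First European Congress of
  Mathematics II (1994), 497–512.
* M. Hoffman, *The algebra of multiple harmonic series*, J. Algebra 194 (1997), 477–495.
* F. Brown, *Mixed Tate motives over ℤ*, Ann. of Math. 175 (2012), 949–976.
-/

noncomputable section

open scoped BigOperators

namespace Literature.NumberTheory.Transcendental

namespace MZV

/-- An index `s = (s₁, …, s_k)` is *admissible* if all entries are positive and, when `s` is
nonempty, the first entry is at least `2`; this is exactly the convergence condition for the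
multiple zeta series (Zagier 1994, §1). The empty index is admissible. [cite: Zagier1994, §1] -/
def IsAdmissible (s : List ℕ) : Prop :=
  (∀ i ∈ s, 1 ≤ i) ∧ ∀ h : s ≠ [], 2 ≤ s.head h

/-- The *weight* `s₁ + ⋯ + s_k` of an index (Zagier 1994, §1). [cite: Zagier1994, §1] -/
def weight (s : List ℕ) : ℕ := s.sum

/-- The *depth* `k` of an index `(s₁, …, s_k)` (Zagier 1994, §1). [cite: Zagier1994, §1] -/
def depth (s : List ℕ) : ℕ := s.length

/-- A *Hoffman index*: all entries lie in `{2, 3}`. Hoffman (1997) conjectured, and Brown (2012)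
proved, that the corresponding MZVs span all MZVs over `ℚ`. [cite: Hoffman1997] -/
def IsHoffman (s : List ℕ) : Prop := ∀ i ∈ s, i = 2 ∨ i = 3

/-- `instance` — interim instance carried over undocumented from `harness21/H21/H21/Prelude/TranscendEllArithS/MultipleZeta.lean:63` (docstring generated by the M5 import). [folklore] -/
instance (s : List ℕ) : Decidable (IsAdmissible s) := by
  unfold IsAdmissible; infer_instance

/-- `instance` — interim instance carried over undocumented from `harness21/H21/H21/Prelude/TranscendEllArithS/MultipleZeta.lean:66` (docstring generated by the M5 import). [folklore] -/
instance (s : List ℕ) : Decidable (IsHoffman s) := by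
  unfold IsHoffman; infer_instance

/-- A Hoffman index is admissible (all entries are `≥ 2`). [folklore] -/
theorem IsHoffman.isAdmissible {s : List ℕ} (h : IsHoffman s) : IsAdmissible s := by
  refine ⟨fun i hi => ?_, fun hs => ?_⟩
  · rcases h i hi with rfl | rfl <;> decide
  · rcases h _ (List.head_mem hs) with h2 | h3 <;> omega

/-- The weight of the empty index is `0`. [folklore] -/
@[simp] theorem weight_nil : weight [] = 0 := rfl

/-- The depth of the empty index is `0`. [folklore] -/
@[simp] theorem depth_nil : depth [] = 0 := rfl

/-- The empty index is admissible. [folklore] -/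
theorem isAdmissible_nil : IsAdmissible [] := ⟨fun _ h => by simp at h, fun h => (h rfl).elim⟩

end MZV

/-- The summation domain of the multiple zeta series for an index of length `k`: strictly
decreasing tuples `n₁ > n₂ > ⋯ > n_k` of positive integers (Zagier 1994, §1). [cite: Zagier1994, §1] -/
def mzvIndexSet (k : ℕ) : Set (Fin k → ℕ) := {n | StrictAnti n ∧ ∀ i, 0 < n i}

/-- The general term `∏ᵢ nᵢ^{-sᵢ}` of the multiple zeta series (Zagier 1994, §1). [cite: Zagier1994, §1] -/
def mzvTerm (s : List ℕ) (n : Fin s.length → ℕ) : ℝ := ∏ i, ((n i : ℝ) ^ s[i])⁻¹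

/-- The *multiple zeta value*
`ζ(s₁, …, s_k) = ∑_{n₁ > ⋯ > n_k ≥ 1} n₁^{-s₁} ⋯ n_k^{-s_k}` (Zagier 1994, §1), as a real number.
Defined as a `tsum`, hence `0` (junk value) when the series is not summable, e.g. for
non-admissible indices such as `[1]`. [cite: Zagier1994, §1] -/
def multipleZeta (s : List ℕ) : ℝ := ∑' n : mzvIndexSet s.length, mzvTerm s n.1

/-- The `ℚ`-subspace `𝒵_w ⊆ ℝ` spanned by the multiple zeta values of admissible indices of
weight `w` (Zagier 1994, §1). [cite: Zagier1994, §1] -/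
def mzvSpace (w : ℕ) : Submodule ℚ ℝ :=
  Submodule.span ℚ {x | ∃ s, MZV.IsAdmissible s ∧ MZV.weight s = w ∧ x = multipleZeta s}

/-- The `ℚ`-span of the *Hoffman elements* `ζ(s)`, `s ∈ {2,3}^k`, of weight `w`
(Hoffman 1997; Brown 2012, Theorem 1.1). [cite: Hoffman1997] -/
def hoffmanSpan (w : ℕ) : Submodule ℚ ℝ :=
  Submodule.span ℚ {x | ∃ s, MZV.IsHoffman s ∧ MZV.weight s = w ∧ x = multipleZeta s}

/-- Zagier's conjectural dimensions `d_w` of `𝒵_w`: `d₀ = 1`, `d₁ = 0`, `d₂ = 1`,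
`d_w = d_{w-2} + d_{w-3}`, i.e. `∑ d_w t^w = 1 / (1 - t² - t³)` (Zagier 1994, §1). [cite: Zagier1994, §1] -/
def zagierDim : ℕ → ℕ
  | 0 => 1
  | 1 => 0
  | 2 => 1
  | n + 3 => zagierDim (n + 1) + zagierDim n

/-! ### API -/

/-- `ζ(∅) = 1`: the empty index gives the empty product summed over the one-point set. [folklore] -/
theorem multipleZeta_nil : multipleZeta [] = 1 := by
  have h : mzvIndexSet 0 = Set.univ := by
    ext n; simp [mzvIndexSet, StrictAnti, IsEmpty.forall_iff]
  unfold multipleZeta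
  simp only [mzvTerm, List.length_nil, Finset.univ_eq_empty, Finset.prod_empty]
  rw [tsum_const, Nat.card_congr (Equiv.Set.univ _ |>.symm.trans (Equiv.setCongr h.symm)).symm]
  simp

/-- The multiple zeta series of an admissible index converges (Zagier 1994, §1). [cite: Zagier1994, §1] -/
def summable_of_isAdmissible : Prop :=
  ∀ {s : List ℕ} (hs : MZV.IsAdmissible s),
    Summable fun n : mzvIndexSet s.length => mzvTerm s n.1

/-- Depth one: `ζ(k) = ∑_{n ≥ 1} n^{-k}` for `k ≥ 2` (Zagier 1994, §1). [cite: Zagier1994, §1] -/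
def multipleZeta_singleton : Prop :=
  ∀ {k : ℕ} (hk : 2 ≤ k),
    multipleZeta [k] = ∑' n : ℕ, 1 / ((n : ℝ) + 1) ^ k

/-- Depth one and Mathlib's `riemannZeta`: `(ζ(k) : ℂ) = riemannZeta k` for `k ≥ 2`
(cf. `zeta_nat_eq_tsum_of_gt_one`). [cite: ZagierECM1994, §9 (multiple zeta values; depth one is ζ(k))] -/
def ofReal_multipleZeta_singleton : Prop :=
  ∀ {k : ℕ} (hk : 2 ≤ k),
    (multipleZeta [k] : ℂ) = riemannZeta k

/-- Multiple zeta values of nonempty admissible indices are positive reals (Zagier 1994, §1). [cite: Zagier1994, §1] -/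
def multipleZeta_pos_of_isAdmissible : Prop :=
  ∀ {s : List ℕ} (hs : MZV.IsAdmissible s),
    0 < multipleZeta s

/-- `𝒵₀ = ℚ · 1`: the only admissible index of weight `0` is the empty one, and `ζ(∅) = 1`. [folklore] -/
theorem mzvSpace_zero_eq : mzvSpace 0 = Submodule.span ℚ {1} := by
  unfold mzvSpace
  congr 1
  ext x
  simp only [Set.mem_setOf_eq, Set.mem_singleton_iff]
  constructor
  · rintro ⟨s, hs, hw, rfl⟩
    have : s = [] := by
      rcases s with _ | ⟨a, t⟩
      · rfl
      · exfalso
        have := hs.2 (List.cons_ne_nil a t)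
        simp [MZV.weight] at hw this
        omega
    subst this
    exact multipleZeta_nil
  · rintro rfl
    exact ⟨[], MZV.isAdmissible_nil, rfl, multipleZeta_nil.symm⟩

/-- `𝒵_a · 𝒵_b ⊆ 𝒵_{a+b}`: the product of two MZVs of weights `a`, `b` is a `ℤ`-linear combination
of MZVs of weight `a + b` (stuffle / harmonic product; Hoffman 1997, Zagier 1994, §1). [cite: Hoffman1997, Zagier 1994  §1] -/
def mem_mzvSpace_mul : Prop :=
  ∀ {a b : ℕ} {x y : ℝ} (hx : x ∈ mzvSpace a) (hy : y ∈ mzvSpace b),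
    x * y ∈ mzvSpace (a + b)

/-- The first Zagier dimensions: `d₀, …, d₁₂ = 1, 0, 1, 1, 1, 2, 2, 3, 4, 5, 7, 9, 12`
(Zagier 1994, §1). [cite: Zagier1994, §1] -/
theorem zagierDim_values :
    (List.range 13).map zagierDim = [1, 0, 1, 1, 1, 2, 2, 3, 4, 5, 7, 9, 12] := by
  decide

/-- The Hoffman span is contained in the space of all MZVs of the same weight. [folklore] -/
theorem hoffmanSpan_le_mzvSpace (w : ℕ) : hoffmanSpan w ≤ mzvSpace w := by
  refine Submodule.span_mono ?_
  rintro x ⟨s, hs, hw, rfl⟩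
  exact ⟨s, hs.isAdmissible, hw, rfl⟩

/-- Euler's identity `ζ(2,1) = ζ(3)` (Euler 1775; Zagier 1994, §1). [cite: Zagier1994, §1] -/
def euler_zeta_two_one : Prop :=
  multipleZeta [2, 1] = multipleZeta [3]

end Literature.NumberTheory.Transcendental
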